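import Mathlib.Analysis.SpecialFunctions.Gamma.Beta
import Mathlib.Analysis.SpecialFunctions.Pow.Complex
import Mathlib.Analysis.SpecialFunctions.Trigonometric.Basic
import Mathlib.Tactic.LinearCombination
import HarnessLib

/-!
# The period constant of the exceptional Hodge class of the sextic Fermat fourfold (proved value)

Topic: `Literature/Analysis/SpecialFunctions`. For a Hodge character `a = (a₀,…,a_{n+1})` of the
Fermat hypersurface `X^n_d : x₀^d + ⋯ + x_{n+1}^d = 0`, Deligne's normalised period constant is
`Γ̃(a) = (2πi)^{-⟨a⟩} ∏ᵢ Γ(aᵢ/d)` with `⟨a⟩ = n/2 + 1` (Deligne, *Hodge cycles on abelian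
varieties*, LNM 900 (1982), I §7, (7.5), Prop. 7.13, Thm. 7.15: `Γ̃(a)` is algebraic and
generates an abelian extension of `ℚ(ζ_d)`). For the sextic fourfold `X^4_6` (`d = 6`, `n = 4`)
the multiset character `a = (1,1,4,4,4,4)` represents the only `(ℤ/6)^×`-orbit of Hodge classes
whose period constant does not lie in `ℚ(ζ₁₂)`: Braun–Fortin–Lopez Garcia–Villaflor Loyola
exhibit the corresponding algebraic cycles over `ℚ(i, 2^{1/3})` (JHEP 06 (2024) 046,
arXiv:2401.00470, §2, the surfaces `S`, `T` on pp. 4–5) and evaluate the relevant `Γ`-ratios by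
reflection and duplication (ibid. §5.1, p. 11).

This file PROVES the exact value (a kernel certificate for one entry of the pub-hlocus
`ABSHODGE` table; engine A of that cell derives `Γ̃(1,1,4,4,4,4) = i·2^{1/3}/3` from the
reflection/distribution relation lattice and certifies it numerically to 600 bits):

  `Γ(1/6)² Γ(2/3)⁴ = (8/3)·2^{1/3}·π³`, hence `Γ(1/6)² Γ(4/6)⁴ / (2πi)³ = i·2^{1/3}/3`.

Mathlib status (searched `Gamma_mul_Gamma_add_half`, `Gamma_mul_Gamma_one_sub`,
`sin_pi_div_three`): Legendre duplication, reflection and `sin(π/3) = √3/2` are in Mathlib; the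
value itself is not. No named fact is introduced.

## Sources

* P. Deligne, *Hodge cycles on abelian varieties* (notes by J. Milne), in LNM 900, Springer 1982,
  I §7, Thm. 7.15.
* A. P. Braun, H. Fortin, D. Lopez Garcia, R. Villaflor Loyola, *More on G-flux and general Hodge
  cycles on the Fermat sextic*, JHEP 06 (2024) 046, arXiv:2401.00470, §2 and §5.1.
-/

noncomputable section

open scoped Real

namespace Literature.Analysis.SpecialFunctions

/-- `Γ(1/6)² · Γ(2/3)⁴ = (8/3) · 2^{1/3} · π³` (Legendre duplication at `s = 1/6`, reflection at
`z = 1/3`, `sin(π/3) = √3/2`).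
[cite: Deligne1982HodgeCycles, I Thm. 7.15] [cite: BraunEtAl2024, §5.1] -/
theorem Real_Gamma_one_sixth_sq_mul_Gamma_two_thirds_pow_four :
    Real.Gamma (1 / 6) ^ 2 * Real.Gamma (2 / 3) ^ 4 =
      8 / 3 * (2 : ℝ) ^ ((1 : ℝ) / 3) * π ^ 3 := by
  -- Legendre duplication: Γ(1/6) Γ(2/3) = Γ(1/3) · 2^{2/3} · √π
  have hdup := Real.Gamma_mul_Gamma_add_half (1 / 6 : ℝ)
  rw [show (1 : ℝ) - 2 * (1 / 6) = 2 / 3 by norm_num, show (2 : ℝ) * (1 / 6) = 1 / 3 by norm_num,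
    show (1 / 6 : ℝ) + 1 / 2 = 2 / 3 by norm_num] at hdup
  -- reflection: Γ(1/3) Γ(2/3) = π / sin(π/3) = π / (√3/2)
  have hrefl := Real.Gamma_mul_Gamma_one_sub (1 / 3 : ℝ)
  rw [show (1 : ℝ) - 1 / 3 = 2 / 3 by norm_num, show π * (1 / 3 : ℝ) = π / 3 by ring,
    Real.sin_pi_div_three] at hrefl
  have hs : (π / (Real.sqrt 3 / 2)) ^ 2 = 4 * π ^ 2 / 3 := by
    rw [div_pow, div_pow, Real.sq_sqrt (by norm_num : (0 : ℝ) ≤ 3)]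
    ring
  have hpow : ((2 : ℝ) ^ ((2 : ℝ) / 3)) ^ 2 = 2 * (2 : ℝ) ^ ((1 : ℝ) / 3) := by
    rw [sq, ← Real.rpow_add (by norm_num : (0 : ℝ) < 2),
      show (2 : ℝ) / 3 + 2 / 3 = 1 + 1 / 3 by norm_num, Real.rpow_add (by norm_num : (0 : ℝ) < 2),
      Real.rpow_one]
  calc Real.Gamma (1 / 6) ^ 2 * Real.Gamma (2 / 3) ^ 4
      = (Real.Gamma (1 / 6) * Real.Gamma (2 / 3)) ^ 2 * Real.Gamma (2 / 3) ^ 2 := by ring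
    _ = (Real.Gamma (1 / 3) * (2 : ℝ) ^ ((2 : ℝ) / 3) * Real.sqrt π) ^ 2 *
          Real.Gamma (2 / 3) ^ 2 := by rw [hdup]
    _ = (Real.Gamma (1 / 3) * Real.Gamma (2 / 3)) ^ 2 * ((2 : ℝ) ^ ((2 : ℝ) / 3)) ^ 2 *
          (Real.sqrt π) ^ 2 := by ring
    _ = (π / (Real.sqrt 3 / 2)) ^ 2 * ((2 : ℝ) ^ ((2 : ℝ) / 3)) ^ 2 * π := by
          rw [hrefl, Real.sq_sqrt Real.pi_pos.le]
    _ = 8 / 3 * (2 : ℝ) ^ ((1 : ℝ) / 3) * π ^ 3 := by rw [hs, hpow]; ring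

/-- Deligne's normalised period constant of the Hodge character `(1,1,4,4,4,4)` of the sextic
Fermat fourfold: `Γ(1/6)² Γ(4/6)⁴ / (2πi)³ = i · 2^{1/3} / 3` (real `Γ`, cast to `ℂ`).
[cite: Deligne1982HodgeCycles, I Thm. 7.15] [cite: BraunEtAl2024, §2] -/
theorem gammaTilde_sexticFermatFourfold_114444 :
    ((Real.Gamma (1 / 6) : ℂ) ^ 2 * (Real.Gamma (4 / 6) : ℂ) ^ 4) / (2 * π * Complex.I) ^ 3 =
      Complex.I * ((2 : ℝ) ^ ((1 : ℝ) / 3) : ℝ) / 3 := by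
  have h46 : (4 / 6 : ℝ) = 2 / 3 := by norm_num
  have hmain := Real_Gamma_one_sixth_sq_mul_Gamma_two_thirds_pow_four
  have hcast : ((Real.Gamma (1 / 6) : ℂ) ^ 2 * (Real.Gamma (4 / 6) : ℂ) ^ 4) =
      ((8 / 3 * (2 : ℝ) ^ ((1 : ℝ) / 3) * π ^ 3 : ℝ) : ℂ) := by
    rw [h46, ← hmain]; push_cast; ring
  have hden : (2 * (π : ℂ) * Complex.I) ^ 3 = -8 * (π : ℂ) ^ 3 * Complex.I := by
    linear_combination (8 * (π : ℂ) ^ 3 * Complex.I) * Complex.I_sq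
  have hpi : (π : ℂ) ≠ 0 := Complex.ofReal_ne_zero.mpr Real.pi_pos.ne'
  have hne : -8 * (π : ℂ) ^ 3 * Complex.I ≠ 0 :=
    mul_ne_zero (mul_ne_zero (by norm_num) (pow_ne_zero 3 hpi)) Complex.I_ne_zero
  rw [hcast, hden, div_eq_iff hne]
  push_cast
  linear_combination (8 / 3 * (π : ℂ) ^ 3 * (((2 : ℝ) ^ ((1 : ℝ) / 3) : ℝ) : ℂ)) * Complex.I_sq

/-- The same value with complex `Γ` and the principal cube root `(2 : ℂ) ^ (1/3 : ℂ)`: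
`Γ(1/6)² Γ(4/6)⁴ (2πi)^{-3} = i · 2^{1/3} / 3`, i.e. `Γ̃(1,1,4,4,4,4) ∈ ℚ(i, 2^{1/3})`, not in
`ℚ(ζ₁₂)`. [cite: Deligne1982HodgeCycles, I Thm. 7.15] [cite: BraunEtAl2024, §2] -/
theorem Complex_gammaTilde_sexticFermatFourfold_114444 :
    Complex.Gamma (1 / 6) ^ 2 * Complex.Gamma (4 / 6) ^ 4 / (2 * π * Complex.I) ^ 3 =
      Complex.I * (2 : ℂ) ^ ((1 : ℂ) / 3) / 3 := by
  have h := gammaTilde_sexticFermatFourfold_114444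
  have h1 : Complex.Gamma (1 / 6) = (Real.Gamma (1 / 6) : ℂ) := by
    rw [← Complex.Gamma_ofReal]; push_cast; ring_nf
  have h2 : Complex.Gamma (4 / 6) = (Real.Gamma (4 / 6) : ℂ) := by
    rw [← Complex.Gamma_ofReal]; push_cast; ring_nf
  have h3 : (((2 : ℝ) ^ ((1 : ℝ) / 3) : ℝ) : ℂ) = (2 : ℂ) ^ ((1 : ℂ) / 3) := by
    rw [Complex.ofReal_cpow (by norm_num : (0 : ℝ) ≤ 2)]; push_cast; ring_nf
  rw [h1, h2, ← h3]
  exact h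

end Literature.Analysis.SpecialFunctions
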